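import Summits.CriticalPhenomena.Ising3DConformalLimit.Theses.CurrentConnectionInvariance
import HarnessLib

/-!
# `NormalisedU4Nonvanishing` ⟸ `LimitExists ∧ NonGaussianLimit` — the crux of route
# `CurrentConnectionInvariance` read through the scaling limit (typed decomposition, crux strategist)

Crux item stmt-CriticalPhenomena-4843 `NormalisedU4Nonvanishing` (rank 5, route
`CurrentConnectionInvariance`, sub-problem `Ising3DConformalLimit`): there are a non-coincident
`x ∈ (ℝ³)⁴` and `ε > 0` such that, frequently as `δ → 0⁺`,
`ε · G^δ₂(x₀,x₁) G^δ₂(x₂,x₃) ≤ |U₄^δ(x)|` for the weight-free (`ρ ≡ 1`) rescaled critical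
correlators `G^δ_n = rescaledCorrelator (criticalCorr 3) 1 n δ` of the nearest-neighbour Ising model
on `ℤ³` — the `Δ`-free, `ρ`-free LATTICE form of clause (iii) of the conjunct.

**Decomposition (this file, sorry-free).**  Let
* `LimitExists` := `∃ ρ S, (ρ > 0 on (0,1]) ∧ HasPointwiseScalingLimit (criticalCorr 3) ρ S ∧
  IsNondegenerateTwoPoint S` — existence of a non-degenerate pointwise scaling limit (item
  stmt-CriticalPhenomena-4738, shared; the existence burden of the route's own `RatioLimit`/two-point law);
* `NonGaussianLimit` := `∀ ρ S, (ρ > 0 on (0,1]) → HasPointwiseScalingLimit (criticalCorr 3) ρ S →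
  IsNondegenerateTwoPoint S → HasNontrivialU4 S` — every such limit is non-Gaussian (item
  stmt-CriticalPhenomena-0636, shared by five routes).

Then
* `normalisedU4Nonvanishing_of_limit : LimitExists → NonGaussianLimit → NormalisedU4Nonvanishing`
  (THE ASSEMBLY).  Proof: take the limit `(ρ, S)`; `NonGaussianLimit` gives a non-coincident `x` with
  `A := U₄(S)(x) ≠ 0`; along the FULL filter `𝓝[>] 0` the rescaled lattice Ursell function
  `ρ(δ)⁴ U₄^δ(x)` converges to `A` and `ρ(δ)⁴ G^δ₂G^δ₂` to `B := S₂(x₀,x₁)S₂(x₂,x₃) > 0` (pointwise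
  convergence at `x` and at the pairs, which are non-coincident); with `ε := |A|/(2B)` eventually
  `ε ρ⁴GG < |ρ⁴U₄|`, and `ρ(δ) > 0` on `(0,1]` un-rescales (the weights cancel — the route's point);
  eventually implies frequently.
* `nonGaussianLimit_of_normalisedU4Nonvanishing : NormalisedU4Nonvanishing → NonGaussianLimit`
  (CALIBRATION — the second piece does not over-shoot: it is a CONSEQUENCE of the crux; the route
  header's "(U) implies item 0636").  Proof: along the frequent set multiply by `ρ(δ)⁴ > 0`; if
  `|A| < εB` the reverse strict inequality would hold eventually, contradicting frequently.
Hence, modulo `LimitExists`, the crux is EXACTLY clause (iii) for the limit; neither piece alone gives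
the crux (`LimitExists` says nothing about `U₄`; `NonGaussianLimit` is vacuous without a limit), and
the cheap probes `piece → crux`, `piece → conjunct` (`exact? | simpa | aesop`) all fail (strategist's
`bc/*_probe.lean`, rc 1 each).

References: M. Aizenman, Comm. Math. Phys. 86 (1982) §1 [AizenmanCMP1982]; M. Aizenman,
H. Duminil-Copin, Ann. of Math. 194 (2021), eq. (3.11) [AizenmanDuminilCopinAnnals2021] (the merging
reading of the normalised Ursell function); strategist census of the sibling crux
`Cruxes/IndependentStrandsJoin/STRATEGY-CENSUS.md` (p1, O1: existence of the limit converts lattice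
non-Gaussianity statements into properties of one continuum object).
-/

noncomputable section

open Filter Topology
open Literature.Probability.LatticeModels

namespace Summit.CriticalPhenomena.Ising3DConformalLimit.CurrentConnectionInvarianceNormalisedU4NonvanishingSplit

open Summit.CriticalPhenomena.Ising3DConformalLimit.Theses.CurrentConnectionInvariance (NormalisedU4Nonvanishing)

/-! ### Elementary lemmas -/

/-- `![a, b]` is injective as soon as `a ≠ b`. [folklore] -/
theorem injective_vecCons_pair {α : Type*} {a b : α} (h : a ≠ b) : Function.Injective ![a, b] := by
  intro i j hij
  fin_cases i <;> fin_cases j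
  · rfl
  · exact absurd hij (by simpa using h)
  · exact absurd hij (by simpa using h.symm)
  · rfl

/-- The weights factor out: `rescaledCorrelator G ρ n δ y = ρ(δ)ⁿ · rescaledCorrelator G 1 n δ y`
(the `ρ ≡ 1` correlator is the bare lattice correlator at the sites `[yᵢ/δ]`). [folklore] -/
theorem rescaledCorrelator_eq_pow_mul {d : ℕ} (G : LatticeCorrFamily d) (ρ : ℝ → ℝ) (n : ℕ) (δ : ℝ)
    (y : Fin n → EuclideanSpace ℝ (Fin d)) :
    rescaledCorrelator G ρ n δ y = ρ δ ^ n * rescaledCorrelator G 1 n δ y := by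
  simp [rescaledCorrelator_apply]

/-- Meshes in `(0,1]` are eventual for `δ → 0⁺`. [folklore] -/
theorem eventually_mem_Ioc : ∀ᶠ δ in 𝓝[>] (0 : ℝ), δ ∈ Set.Ioc (0 : ℝ) 1 :=
  Ioc_mem_nhdsGT one_pos

section limit

variable {ρ : ℝ → ℝ} {S : CorrFamily 3}

/-- Convergence of the rescaled `n`-point correlator at a non-coincident configuration, written with
the weight factored out. [folklore] -/
theorem tendsto_pow_mul_rescaledCorrelator (hlim : HasPointwiseScalingLimit (criticalCorr 3) ρ S)
    {n : ℕ} {y : Fin n → EuclideanSpace ℝ (Fin 3)} (hy : y ∈ NonCoincident 3 n) :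
    Tendsto (fun δ : ℝ => ρ δ ^ n * rescaledCorrelator (criticalCorr 3) 1 n δ y) (𝓝[>] (0 : ℝ))
      (𝓝 (S n y)) := by
  refine ((hlim n).tendsto_at hy).congr fun δ => ?_
  exact rescaledCorrelator_eq_pow_mul (criticalCorr 3) ρ n δ y

/-- The rescaled lattice Ursell function at `x` converges to the continuum one, and the rescaled
normalisation `G^δ₂(x₀,x₁)G^δ₂(x₂,x₃)` to `S₂S₂`. [folklore] -/
theorem tendsto_U4_and_GG (hlim : HasPointwiseScalingLimit (criticalCorr 3) ρ S)
    {x : Fin 4 → EuclideanSpace ℝ (Fin 3)} (hx : x ∈ NonCoincident 3 4) :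
    Tendsto (fun δ : ℝ => ρ δ ^ 4 *
        (rescaledCorrelator (criticalCorr 3) 1 4 δ x -
          (rescaledCorrelator (criticalCorr 3) 1 2 δ ![x 0, x 1] * rescaledCorrelator (criticalCorr 3) 1 2 δ ![x 2, x 3] +
            rescaledCorrelator (criticalCorr 3) 1 2 δ ![x 0, x 2] * rescaledCorrelator (criticalCorr 3) 1 2 δ ![x 1, x 3] +
            rescaledCorrelator (criticalCorr 3) 1 2 δ ![x 0, x 3] * rescaledCorrelator (criticalCorr 3) 1 2 δ ![x 1, x 2])))
        (𝓝[>] (0 : ℝ)) (𝓝 (limitConnectedFour S x)) ∧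
      Tendsto (fun δ : ℝ => ρ δ ^ 4 *
        (rescaledCorrelator (criticalCorr 3) 1 2 δ ![x 0, x 1] * rescaledCorrelator (criticalCorr 3) 1 2 δ ![x 2, x 3]))
        (𝓝[>] (0 : ℝ)) (𝓝 (S 2 ![x 0, x 1] * S 2 ![x 2, x 3])) := by
  have hxinj : Function.Injective x := hx
  have h4 := tendsto_pow_mul_rescaledCorrelator hlim hx
  have h2 : ∀ a b : Fin 4, a ≠ b →
      Tendsto (fun δ : ℝ => ρ δ ^ 2 * rescaledCorrelator (criticalCorr 3) 1 2 δ ![x a, x b])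
        (𝓝[>] (0 : ℝ)) (𝓝 (S 2 ![x a, x b])) := fun a b hab =>
    tendsto_pow_mul_rescaledCorrelator hlim (injective_vecCons_pair (hxinj.ne hab))
  constructor
  · have h := h4.sub ((((h2 0 1 (by decide)).mul (h2 2 3 (by decide))).add
      ((h2 0 2 (by decide)).mul (h2 1 3 (by decide)))).add
      ((h2 0 3 (by decide)).mul (h2 1 2 (by decide))))
    refine h.congr fun δ => ?_
    ring
  · exact ((h2 0 1 (by decide)).mul (h2 2 3 (by decide))).congr fun δ => by ring

/-- **Pointwise core of the assembly.**  If a non-degenerate pointwise scaling limit `(ρ, S)` has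
`U₄(S)(x) ≠ 0` at a non-coincident `x`, then with `ε = |U₄(S)(x)| / (2 S₂S₂)` the crux's inequality
holds at `x` for ALL small meshes. [folklore] -/
theorem eventually_normalisedU4_of_limit (hρ : ∀ δ ∈ Set.Ioc (0 : ℝ) 1, 0 < ρ δ)
    (hlim : HasPointwiseScalingLimit (criticalCorr 3) ρ S) (hnd : IsNondegenerateTwoPoint S)
    {x : Fin 4 → EuclideanSpace ℝ (Fin 3)} (hx : x ∈ NonCoincident 3 4)
    (hA : limitConnectedFour S x ≠ 0) :
    ∃ ε : ℝ, 0 < ε ∧ ∀ᶠ δ in 𝓝[>] (0 : ℝ),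
      ε * (rescaledCorrelator (criticalCorr 3) 1 2 δ ![x 0, x 1] * rescaledCorrelator (criticalCorr 3) 1 2 δ ![x 2, x 3]) ≤
        |rescaledCorrelator (criticalCorr 3) 1 4 δ x -
          (rescaledCorrelator (criticalCorr 3) 1 2 δ ![x 0, x 1] * rescaledCorrelator (criticalCorr 3) 1 2 δ ![x 2, x 3] +
            rescaledCorrelator (criticalCorr 3) 1 2 δ ![x 0, x 2] * rescaledCorrelator (criticalCorr 3) 1 2 δ ![x 1, x 3] +
            rescaledCorrelator (criticalCorr 3) 1 2 δ ![x 0, x 3] * rescaledCorrelator (criticalCorr 3) 1 2 δ ![x 1, x 2])| := by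
  have hxinj : Function.Injective x := hx
  obtain ⟨hU, hG⟩ := tendsto_U4_and_GG hlim hx
  set A : ℝ := limitConnectedFour S x with hAdef
  set B : ℝ := S 2 ![x 0, x 1] * S 2 ![x 2, x 3] with hBdef
  have hBpos : 0 < B :=
    mul_pos (hnd _ (injective_vecCons_pair (hxinj.ne (by decide))))
      (hnd _ (injective_vecCons_pair (hxinj.ne (by decide))))
  have hApos : 0 < |A| := abs_pos.2 hA
  refine ⟨|A| / (2 * B), div_pos hApos (by positivity), ?_⟩
  have hlt : |A| / (2 * B) * B < |A| := by
    have e : |A| / (2 * B) * B = |A| / 2 := by field_simp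
    rw [e]
    linarith
  have hev := (hG.const_mul (|A| / (2 * B))).eventually_lt hU.abs hlt
  filter_upwards [hev, eventually_mem_Ioc] with δ hδ hmem
  have hρ4 : 0 < ρ δ ^ 4 := pow_pos (hρ δ hmem) 4
  rw [abs_mul, abs_of_pos hρ4] at hδ
  -- `ε · ρ⁴GG < ρ⁴|U₄|`; divide by `ρ⁴ > 0`
  have key : ρ δ ^ 4 * (|A| / (2 * B) *
      (rescaledCorrelator (criticalCorr 3) 1 2 δ ![x 0, x 1] * rescaledCorrelator (criticalCorr 3) 1 2 δ ![x 2, x 3])) <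
      ρ δ ^ 4 * |rescaledCorrelator (criticalCorr 3) 1 4 δ x -
          (rescaledCorrelator (criticalCorr 3) 1 2 δ ![x 0, x 1] * rescaledCorrelator (criticalCorr 3) 1 2 δ ![x 2, x 3] +
            rescaledCorrelator (criticalCorr 3) 1 2 δ ![x 0, x 2] * rescaledCorrelator (criticalCorr 3) 1 2 δ ![x 1, x 3] +
            rescaledCorrelator (criticalCorr 3) 1 2 δ ![x 0, x 3] * rescaledCorrelator (criticalCorr 3) 1 2 δ ![x 1, x 2])| := by
    linarith
  exact (lt_of_mul_lt_mul_left key hρ4.le).le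

/-- **Pointwise core of the converse.**  If the crux's inequality holds at `x` with constant `ε`
frequently as `δ → 0⁺`, then every non-degenerate pointwise scaling limit has
`ε · S₂S₂ ≤ |U₄(S)(x)|`, in particular `U₄(S)(x) ≠ 0`. [folklore] -/
theorem le_abs_limitConnectedFour_of_frequently (hρ : ∀ δ ∈ Set.Ioc (0 : ℝ) 1, 0 < ρ δ)
    (hlim : HasPointwiseScalingLimit (criticalCorr 3) ρ S)
    {x : Fin 4 → EuclideanSpace ℝ (Fin 3)} (hx : x ∈ NonCoincident 3 4) {ε : ℝ}
    (hfreq : ∃ᶠ δ in 𝓝[>] (0 : ℝ),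
      ε * (rescaledCorrelator (criticalCorr 3) 1 2 δ ![x 0, x 1] * rescaledCorrelator (criticalCorr 3) 1 2 δ ![x 2, x 3]) ≤
        |rescaledCorrelator (criticalCorr 3) 1 4 δ x -
          (rescaledCorrelator (criticalCorr 3) 1 2 δ ![x 0, x 1] * rescaledCorrelator (criticalCorr 3) 1 2 δ ![x 2, x 3] +
            rescaledCorrelator (criticalCorr 3) 1 2 δ ![x 0, x 2] * rescaledCorrelator (criticalCorr 3) 1 2 δ ![x 1, x 3] +
            rescaledCorrelator (criticalCorr 3) 1 2 δ ![x 0, x 3] * rescaledCorrelator (criticalCorr 3) 1 2 δ ![x 1, x 2])|) :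
    ε * (S 2 ![x 0, x 1] * S 2 ![x 2, x 3]) ≤ |limitConnectedFour S x| := by
  obtain ⟨hU, hG⟩ := tendsto_U4_and_GG hlim hx
  by_contra hcon
  push Not at hcon
  -- the reverse strict inequality holds eventually after rescaling …
  have hev := hU.abs.eventually_lt (hG.const_mul ε) hcon
  -- … contradicting the frequent inequality
  have hboth := hfreq.and_eventually (hev.and eventually_mem_Ioc)
  obtain ⟨δ, hle, hlt, hmem⟩ := hboth.exists
  have hρ4 : 0 < ρ δ ^ 4 := pow_pos (hρ δ hmem) 4
  rw [abs_mul, abs_of_pos hρ4] at hlt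
  have key := mul_le_mul_of_nonneg_left hle hρ4.le
  linarith

end limit

/-! ### The assembly and its calibration -/

/-- **ASSEMBLY (typed decomposition of the crux).**
`LimitExists → NonGaussianLimit → NormalisedU4Nonvanishing`: existence of a non-degenerate pointwise
scaling limit of the critical correlators on `ℤ³` (item stmt-CriticalPhenomena-4738) and
non-Gaussianity of every such limit (item stmt-CriticalPhenomena-0636) give the crux
`NormalisedU4Nonvanishing` of route `CurrentConnectionInvariance` (item stmt-CriticalPhenomena-4843),
with the inequality holding EVENTUALLY (not only frequently) at the configuration where `U₄(S) ≠ 0`.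
[folklore] -/
theorem normalisedU4Nonvanishing_of_limit
    (hL : ∃ (ρ : ℝ → ℝ) (S : CorrFamily 3), (∀ δ ∈ Set.Ioc (0 : ℝ) 1, 0 < ρ δ) ∧
      HasPointwiseScalingLimit (criticalCorr 3) ρ S ∧ IsNondegenerateTwoPoint S)
    (hNG : ∀ (ρ : ℝ → ℝ) (S : CorrFamily 3), (∀ δ ∈ Set.Ioc (0 : ℝ) 1, 0 < ρ δ) →
      HasPointwiseScalingLimit (criticalCorr 3) ρ S → IsNondegenerateTwoPoint S → HasNontrivialU4 S) :
    NormalisedU4Nonvanishing := by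
  obtain ⟨ρ, S, hρ, hlim, hnd⟩ := hL
  obtain ⟨x, hx, hA⟩ := hNG ρ S hρ hlim hnd
  obtain ⟨ε, hε, hev⟩ := eventually_normalisedU4_of_limit hρ hlim hnd hx hA
  exact ⟨x, hx, ε, hε, hev.frequently⟩

/-- **CALIBRATION (the converse for the second piece).**  The crux implies item
stmt-CriticalPhenomena-0636: every non-degenerate pointwise scaling limit of the critical correlators
on `ℤ³` is non-Gaussian (`ε S₂S₂ ≤ |U₄(S)(x)|` at the crux's configuration). [folklore] -/
theorem nonGaussianLimit_of_normalisedU4Nonvanishing (h : NormalisedU4Nonvanishing) :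
    ∀ (ρ : ℝ → ℝ) (S : CorrFamily 3), (∀ δ ∈ Set.Ioc (0 : ℝ) 1, 0 < ρ δ) →
      HasPointwiseScalingLimit (criticalCorr 3) ρ S → IsNondegenerateTwoPoint S → HasNontrivialU4 S := by
  intro ρ S hρ hlim hnd
  obtain ⟨x, hx, ε, hε, hfreq⟩ := h
  have hxinj : Function.Injective x := hx
  have hle := le_abs_limitConnectedFour_of_frequently hρ hlim hx hfreq
  have hB : 0 < S 2 ![x 0, x 1] * S 2 ![x 2, x 3] :=
    mul_pos (hnd _ (injective_vecCons_pair (hxinj.ne (by decide))))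
      (hnd _ (injective_vecCons_pair (hxinj.ne (by decide))))
  refine ⟨x, hx, abs_pos.1 (lt_of_lt_of_le ?_ hle)⟩
  positivity

end Summit.CriticalPhenomena.Ising3DConformalLimit.CurrentConnectionInvarianceNormalisedU4NonvanishingSplit

end
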